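import Literature.NumberTheory.Automorphic.HyperspecialUnitarySatakeIsomorphism
import HarnessLib

/-!
# The Satake isomorphism of `U(σ, J₀)` over every commutative coefficient ring in which `q_F` is a unit:
# `𝒮_w : ℋ(U_N, K₀; R) ⥲ R[Λ⁻]^W` (Cartier 1979 §IV Thm. 4.1 and its proof; Satake 1963 §6; Mínguez 2011 §4)

Topic `NumberTheory/Automorphic`; namespace `Literature.NumberTheory.Automorphic.HermitianLattice[.UnramifiedLocalConjDatum]`
(lane `lit-hodgefound`, Track 2 foundations; seat `lit-hodgefound-p11`, generation 49, row g49-#1).  One DEFINITION with body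
(`satakeAlgEquivOfUnits`, the `R`-algebra isomorphism) + theorems; no named fact, no instance, no notation.

## The mathematics

`G = U_N = U(σ, J₀^{(N)})` over a `ℤᵐ⁰`-valued field `K` with an unramified conjugation datum `hd` (`σ ≠ id`, finite residue
field of cardinality `q = q_F²`), `K₀ = G ∩ GL_N(𝒪)` hyperspecial.  For a commutative ring `R` and a unit `u ∈ Rˣ` with
`(u : R) = q_F`, the INTEGRAL Satake transform with weight `w = u^{-⟨ν,·⟩}` is the algebra homomorphism
`𝒮_w = hd.isIwasawaExponent.satakeTransform w : ℋ(G, K₀; R) → R[ℤ^N]`, `𝒮_w(T)_μ = #{γ ∈ G/K₀ in T : a(γ) = μ} · u^{-⟨ν,μ⟩}`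
(`SatakeTransformIwasawa`, `HyperspecialUnitarySatakeIwasawaDatum`); for `R = ℂ`, `u = √q` it is the tree's `hd.satakeTransform`.
The tree has: `𝒮_w` is injective over EVERY commutative `R` (`satakeTransform_injective_of_commRing`, Bruhat–Tits (4.4.4) (ii));
`range 𝒮_w ⊆ R[Λ⁻]^W` (`isIwasawaExponent_satakeTransform_mem_unitarySatakeTarget`, the Weyl invariance by Levi descent); and,
over `ℂ`, the surjectivity onto `ℂ[Λ⁻]^W` (`HyperspecialUnitarySatakeIsomorphism`, Cartier's triangular induction, dividing by
the non-zero leading coefficient `#{γ ⊆ K₀ϖ^aK₀ : a(γ) = a} · q^{-⟨ν,a⟩/2}`).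

THEOREM (this file): **for every commutative ring `R` in which `q_F` is a unit, `𝒮_w` maps `ℋ(G, K₀; R)` ONTO `R[Λ⁻]^W`;
hence `𝒮_w : ℋ(U_N, K₀; R) ⥲ R[Λ⁻]^W` is an isomorphism of `R`-algebras** (`satakeAlgEquivOfUnits`).  This is Cartier's
remark that the Satake isomorphism is defined over `ℤ[q^{±1/2}]` ([CartierCorvallis1979] §IV, proof of Thm. 4.1 (c):
«`c(λ, λ) = δ(λ)^{1/2}`», a unit), for the unramified unitary group in every rank; in particular the Satake isomorphism holds
over `ℤ[1/p]`, over `𝔽̄_ℓ` (`ℓ ∤ q`) and over every field of characteristic prime to `q`.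

Proof.  Run the triangular induction of `HyperspecialUnitarySatakeIsomorphism.exists_satakeTransform_eq` over `R`, subtracting
multiples of the transform of the ANTIDOMINANT Cartan operator `T_c = 𝟙_{K₀ ϖ^c K₀}`, `c = -a` (`a ∈ supp f` head-sum maximal,
hence dominant): by Bruhat–Tits (4.4.4) (ii) (`coeff_satakeTransform_doubleCosetOperator_zpowDiagGL_monotone_unitary`) the
coefficient of `x^c` in `𝒮_w(T_c)` is the UNIT `w(c) = u^{-⟨ν,c⟩}` (exactly one coset of `K₀ϖ^cK₀` has exponents `c`), and by the
`w₀ = -1`-symmetry of `𝒮_w` over `R` (`coeff_satakeTransform_neg_of_units_unitary`, where `(u : R) = q_F` enters) so is the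
coefficient of `x^a = x^{-c}`; the exponents of `𝒮_w(T_c)` lie dominance-above `c` ((4.4.4) (i) from the antidominant end,
`sum_ite_lt_le_sum_iwasawaExp_of_mem_orbit`), hence — again by the symmetry — dominance-below `a`.  So
`f - f_a w(c)⁻¹ 𝒮_w(T_c) ∈ R[Λ⁻]^W` has a strictly smaller `U(f)` and the induction on `#U(f)` closes.  No division other
than by the units `w(c)` occurs.

## What is formalised

* §1 `headSum_neg`; **`coeff_neg_satakeTransform_doubleCosetOperator_zpowDiagGL_neg`** (the coefficient of `x^a` in
  `𝒮_w(T_{-a})`, `a` dominant, is the unit `w(-a)`), `isUnit_coeff_satakeTransform_doubleCosetOperator_zpowDiagGL_neg`,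
  **`headSum_le_of_coeff_satakeTransform_doubleCosetOperator_zpowDiagGL_neg_ne_zero`** (triangularity below `a`).
* §2 **`exists_isIwasawaExponent_satakeTransform_eq`** (SURJECTIVITY onto `R[Λ⁻]^W` over `R`),
  **`range_isIwasawaExponent_satakeTransform_eq_unitarySatakeTarget`**, **`satakeAlgEquivOfUnits : ℋ(U_N, K₀; R) ≃ₐ[R] R[Λ⁻]^W`**,
  `coe_satakeAlgEquivOfUnits`, `satakeAlgEquivOfUnits_symm_apply_satakeTransform`, `nonempty_algEquiv_of_isUnit`
  (hypothesis: `q_F` is a unit of `R`).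
* §3 the complex case recovered: `coe_satakeAlgEquivOfUnits_complex` (`u = √q`: the integral isomorphism is `hd.satakeTransform`).

## References
* [CartierCorvallis1979] P. Cartier, *Representations of 𝔭-adic groups: a survey*, PSPM 33.1 (1979), §IV (4.2), Thm. 4.1 and
  its proof (a)–(c).
* [Satake1963] I. Satake, *Theory of spherical functions on reductive algebraic groups over 𝔭-adic fields*, Publ. Math. IHÉS 18
  (1963), §6 Thm. 7, §8.
* [BruhatTits1972] F. Bruhat, J. Tits, *Groupes réductifs sur un corps local I*, Publ. Math. IHÉS 41 (1972), (4.4.3), (4.4.4).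
* [Minguez2011] A. Mínguez, *Unramified representations of unitary groups*, in: *On the stabilization of the trace formula*
  (2011), §4.
* [Macdonald1971] I. G. Macdonald, *Spherical functions on a group of p-adic type*, Madras (1971), Ch. IV–V.
-/

noncomputable section

open scoped Valued WithZero Matrix MatrixGroups
open MonoidAlgebra Representation

namespace Literature.NumberTheory.Automorphic.HermitianLattice

open Literature.NumberTheory.Automorphic Literature.NumberTheory.Automorphic.CartanUnique
  Literature.NumberTheory.Automorphic.SymplecticCartan

variable {N : ℕ}

/-! ## §1 The antidominant Cartan operator `T_{-a}`: unit leading coefficient at `x^a`, exponents below `a` -/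

/-- Head sums of `-μ` are the negatives of those of `μ`. [cite: BruhatTits1972, (4.4.4)] -/
theorem headSum_neg (μ : Fin N → ℤ) (r : ℕ) : headSum (-μ) r = -headSum μ r := by
  rw [headSum, headSum, ← Finset.sum_neg_distrib]
  exact Finset.sum_congr rfl fun i _ => by split_ifs <;> simp

variable {K : Type*} [Field K] [Valued K ℤᵐ⁰] {σ : K →+* K} {ϖ : K} {R : Type*} [CommRing R]

namespace UnramifiedLocalConjDatum

/-- Antisymmetry is preserved by negation. [cite: BruhatTits1972, (4.4.3)] -/
theorem neg_rev_of_rev {a : Fin N → ℤ} (ha : ∀ i, a (Fin.rev i) = -a i) : ∀ i, (-a) (Fin.rev i) = -(-a) i := fun i => by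
  rw [Pi.neg_apply, Pi.neg_apply, ha]

variable [Finite 𝓀[K]]
  [IsHeckeTriple (⊤ : Submonoid (unitaryGroupOfForm σ ((StdForm.antidiagonal N).over K)))
    (unitaryInt σ ((StdForm.antidiagonal N).over K)) (unitaryInt σ ((StdForm.antidiagonal N).over K))]

/-- **The coefficient of `x^a` in `𝒮_w(T_{-a})` is the unit `w(-a)`** (`a` dominant: antitone and antisymmetric; `T_{-a}` the
double-coset operator of `K₀ diag(ϖ^{-a}) K₀`; weight `w = u^{-⟨ν,·⟩}`, `(u : R) = q_F`): by the `w₀`-symmetry of `𝒮_w` over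
`R` the coefficient of `x^a = x^{-(-a)}` equals that of `x^{-a}`, which is `w(-a)` — exactly one coset of `K₀ diag(ϖ^{-a}) K₀`
has the antidominant exponents `-a`. [cite: CartierCorvallis1979, §IV, proof of Thm. 4.1 (c)] [cite: BruhatTits1972, (4.4.4) (ii)] -/
theorem coeff_neg_satakeTransform_doubleCosetOperator_zpowDiagGL_neg (hd : UnramifiedLocalConjDatum σ ϖ) (hσ : ∃ x : K, σ x ≠ x)
    (u : Rˣ) (hu : (u : R) = Nat.sqrt (Nat.card 𝓀[K])) (w : Multiplicative (Fin N → ℤ) →* R)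
    (hw : ∀ e : Fin N → ℤ, w (Multiplicative.ofAdd e) = ((u ^ (-satakeTwistExp e) : Rˣ) : R))
    {a : Fin N → ℤ} (ha : Antitone a ∧ ∀ i, a (Fin.rev i) = -a i) :
    ((hd.isIwasawaExponent (N := N)).satakeTransform w
        (heckeAlgebra.doubleCosetOperator (unitaryInt σ ((StdForm.antidiagonal N).over K))
          (⟨zpowDiagGL (uniformizer_ne_zero hd.vϖ) (-a), zpowDiagGL_mem_unitaryGroupOfForm hd.σϖ _ (neg_rev_of_rev ha.2)⟩ :
            unitaryGroupOfForm σ ((StdForm.antidiagonal N).over K)))).coeff a =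
      w (Multiplicative.ofAdd (-a)) := by
  have hc : Monotone (-a) ∧ ∀ i, (-a) (Fin.rev i) = -(-a) i := ⟨fun i j hij => neg_le_neg (ha.1 hij), neg_rev_of_rev ha.2⟩
  have h := hd.coeff_satakeTransform_neg_of_units_unitary hσ u hu w hw
    (heckeAlgebra.doubleCosetOperator (unitaryInt σ ((StdForm.antidiagonal N).over K))
      (⟨zpowDiagGL (uniformizer_ne_zero hd.vϖ) (-a), zpowDiagGL_mem_unitaryGroupOfForm hd.σϖ _ (neg_rev_of_rev ha.2)⟩ :
        unitaryGroupOfForm σ ((StdForm.antidiagonal N).over K))) (-a)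
  rw [neg_neg] at h
  rw [h]
  exact hd.coeff_satakeTransform_doubleCosetOperator_zpowDiagGL_monotone_unitary w hc rfl

/-- The coefficient of `x^a` in `𝒮_w(T_{-a})` (`a` dominant) is a unit of `R`. [cite: CartierCorvallis1979, §IV, proof of Thm. 4.1 (c)] -/
theorem isUnit_coeff_satakeTransform_doubleCosetOperator_zpowDiagGL_neg (hd : UnramifiedLocalConjDatum σ ϖ) (hσ : ∃ x : K, σ x ≠ x)
    (u : Rˣ) (hu : (u : R) = Nat.sqrt (Nat.card 𝓀[K])) (w : Multiplicative (Fin N → ℤ) →* R)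
    (hw : ∀ e : Fin N → ℤ, w (Multiplicative.ofAdd e) = ((u ^ (-satakeTwistExp e) : Rˣ) : R))
    {a : Fin N → ℤ} (ha : Antitone a ∧ ∀ i, a (Fin.rev i) = -a i) :
    IsUnit (((hd.isIwasawaExponent (N := N)).satakeTransform w
        (heckeAlgebra.doubleCosetOperator (unitaryInt σ ((StdForm.antidiagonal N).over K))
          (⟨zpowDiagGL (uniformizer_ne_zero hd.vϖ) (-a), zpowDiagGL_mem_unitaryGroupOfForm hd.σϖ _ (neg_rev_of_rev ha.2)⟩ :
            unitaryGroupOfForm σ ((StdForm.antidiagonal N).over K)))).coeff a) := by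
  rw [hd.coeff_neg_satakeTransform_doubleCosetOperator_zpowDiagGL_neg hσ u hu w hw ha]
  exact IsIwasawaExponent.isUnit_weight w _

/-- **Triangularity of `𝒮_w(T_{-a})` below `a`** (`a` dominant): if `x^μ` occurs in `𝒮_w(T_{-a})` then `μ ≤ a` in the dominance
order, `∑_{i<r} μ_i ≤ ∑_{i<r} a_i` for all `r` — the exponents of the cosets of `K₀ diag(ϖ^{-a}) K₀` lie dominance-above `-a`
(Bruhat–Tits (4.4.4) (i) from the antidominant end), and the set of exponents of `𝒮_w(T)` is stable under `μ ↦ -μ`.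
[cite: CartierCorvallis1979, §IV, proof of Thm. 4.1 (c)] [cite: BruhatTits1972, (4.4.4) (i)] -/
theorem headSum_le_of_coeff_satakeTransform_doubleCosetOperator_zpowDiagGL_neg_ne_zero (hd : UnramifiedLocalConjDatum σ ϖ)
    (hσ : ∃ x : K, σ x ≠ x) (u : Rˣ) (hu : (u : R) = Nat.sqrt (Nat.card 𝓀[K])) (w : Multiplicative (Fin N → ℤ) →* R)
    (hw : ∀ e : Fin N → ℤ, w (Multiplicative.ofAdd e) = ((u ^ (-satakeTwistExp e) : Rˣ) : R))
    {a : Fin N → ℤ} (ha : Antitone a ∧ ∀ i, a (Fin.rev i) = -a i) {μ : Fin N → ℤ}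
    (hμ : ((hd.isIwasawaExponent (N := N)).satakeTransform w
        (heckeAlgebra.doubleCosetOperator (unitaryInt σ ((StdForm.antidiagonal N).over K))
          (⟨zpowDiagGL (uniformizer_ne_zero hd.vϖ) (-a), zpowDiagGL_mem_unitaryGroupOfForm hd.σϖ _ (neg_rev_of_rev ha.2)⟩ :
            unitaryGroupOfForm σ ((StdForm.antidiagonal N).over K)))).coeff μ ≠ 0) (r : ℕ) :
    headSum μ r ≤ headSum a r := by
  have hc : Monotone (-a) ∧ ∀ i, (-a) (Fin.rev i) = -(-a) i := ⟨fun i j hij => neg_le_neg (ha.1 hij), neg_rev_of_rev ha.2⟩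
  -- pass to `-μ`, whose coefficient is non-zero too
  rw [← hd.coeff_satakeTransform_neg_of_units_unitary hσ u hu w hw _ μ] at hμ
  -- some coset of `K₀ diag(ϖ^{-a}) K₀` has exponents `-μ`
  obtain ⟨γ, hγ, hγμ⟩ : ∃ γ : unitaryGroupOfForm σ ((StdForm.antidiagonal N).over K) ⧸ unitaryInt σ ((StdForm.antidiagonal N).over K),
      γ ∈ MulAction.orbit (unitaryInt σ ((StdForm.antidiagonal N).over K))
        (((⟨zpowDiagGL (uniformizer_ne_zero hd.vϖ) (-a), zpowDiagGL_mem_unitaryGroupOfForm hd.σϖ _ (neg_rev_of_rev ha.2)⟩ :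
            unitaryGroupOfForm σ ((StdForm.antidiagonal N).over K)) :
          unitaryGroupOfForm σ ((StdForm.antidiagonal N).over K) ⧸ unitaryInt σ ((StdForm.antidiagonal N).over K))) ∧
        hd.iwasawaExp γ.out = -μ := by
    by_contra h
    push Not at h
    exact hμ ((hd.isIwasawaExponent (N := N)).coeff_satakeTransform_doubleCosetOperator_eq_zero w h)
  have hγ' : ((γ.out : unitaryGroupOfForm σ ((StdForm.antidiagonal N).over K)) :
      unitaryGroupOfForm σ ((StdForm.antidiagonal N).over K) ⧸ unitaryInt σ ((StdForm.antidiagonal N).over K)) ∈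
      MulAction.orbit (unitaryInt σ ((StdForm.antidiagonal N).over K))
        (((⟨zpowDiagGL (uniformizer_ne_zero hd.vϖ) (-a), zpowDiagGL_mem_unitaryGroupOfForm hd.σϖ _ (neg_rev_of_rev ha.2)⟩ :
            unitaryGroupOfForm σ ((StdForm.antidiagonal N).over K)) :
          unitaryGroupOfForm σ ((StdForm.antidiagonal N).over K) ⧸ unitaryInt σ ((StdForm.antidiagonal N).over K))) := by
    rwa [QuotientGroup.out_eq']
  have h1 := hd.sum_ite_lt_le_sum_iwasawaExp_of_mem_orbit hc rfl hγ' r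
  rw [hγμ, ← headSum_eq, ← headSum_eq, headSum_neg, headSum_neg] at h1
  exact neg_le_neg_iff.1 h1

/-! ## §2 Surjectivity onto `R[Λ⁻]^W` and the `R`-algebra isomorphism -/

/-- **SURJECTIVITY OF THE INTEGRAL SATAKE TRANSFORM ONTO `R[Λ⁻]^W`**: for every commutative ring `R`, every unit `u ∈ Rˣ` with
`(u : R) = q_F`, the weight `w = u^{-⟨ν,·⟩}`, and every `f ∈ R[Λ⁻]^W` there is `T ∈ ℋ(U(σ, J₀^{(N)}), K₀; R)` with `𝒮_w(T) = f`
— Cartier's triangular induction on `#U(f)`, subtracting `f_a w(-a)⁻¹ 𝒮_w(T_{-a})` for the head-sum-maximal (hence dominant)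
exponent `a ∈ supp f`; only the units `w(-a)` are inverted. [cite: CartierCorvallis1979, §IV Thm. 4.1 and its proof (c)]
[cite: Satake1963, §6 Thm. 7] [cite: BruhatTits1972, (4.4.4)] [cite: Minguez2011, §4] -/
theorem exists_isIwasawaExponent_satakeTransform_eq (hd : UnramifiedLocalConjDatum σ ϖ) (hσ : ∃ x : K, σ x ≠ x)
    (u : Rˣ) (hu : (u : R) = Nat.sqrt (Nat.card 𝓀[K])) (w : Multiplicative (Fin N → ℤ) →* R)
    (hw : ∀ e : Fin N → ℤ, w (Multiplicative.ofAdd e) = ((u ^ (-satakeTwistExp e) : Rˣ) : R))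
    (f : AddMonoidAlgebra R (Fin N → ℤ)) (hf : f ∈ unitarySatakeTarget R N) :
    ∃ T : heckeAlgebra R (unitaryGroupOfForm σ ((StdForm.antidiagonal N).over K)) (unitaryInt σ ((StdForm.antidiagonal N).over K)),
      (hd.isIwasawaExponent (N := N)).satakeTransform w T = f := by
  classical
  suffices H : ∀ (m : ℕ) (f : AddMonoidAlgebra R (Fin N → ℤ)), f ∈ unitarySatakeTarget R N →
      (finite_lowerDominantSet f).toFinset.card = m →
      ∃ T : heckeAlgebra R (unitaryGroupOfForm σ ((StdForm.antidiagonal N).over K)) (unitaryInt σ ((StdForm.antidiagonal N).over K)),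
        (hd.isIwasawaExponent (N := N)).satakeTransform w T = f from H _ f hf rfl
  intro m
  induction m using Nat.strong_induction_on with
  | _ m ih =>
  intro f hf hm
  by_cases h0 : f = 0
  · exact ⟨0, by rw [h0, map_zero]⟩
  obtain ⟨hsupp, hW⟩ := (mem_unitarySatakeTarget_iff f).1 hf
  -- the head-sum-maximal exponent `a ∈ supp f` is dominant
  have hSne : f.coeff.support.Nonempty := by
    rw [Finsupp.support_nonempty_iff, ne_eq, AddMonoidAlgebra.coeff_eq_zero]
    exact h0
  obtain ⟨a, haS, hmax⟩ := f.coeff.support.exists_max_image (fun μ => toLex (headSumVec μ)) hSne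
  have haS' : f.coeff a ≠ 0 := Finsupp.mem_support_iff.1 haS
  have hanti : ∀ μ ∈ f.coeff.support, ∀ i, μ (Fin.rev i) = -μ i := fun μ hμ => by
    by_contra h
    exact Finsupp.mem_support_iff.1 hμ (hsupp μ h)
  have hstab : ∀ μ ∈ f.coeff.support, ∀ π : Equiv.Perm (Fin N), (∀ i, π (Fin.rev i) = Fin.rev (π i)) → μ ∘ π ∈ f.coeff.support :=
    fun μ hμ π hπ => by
      rw [Finsupp.mem_support_iff] at hμ ⊢
      rwa [hW π hπ μ]
  have hmono : Antitone a := antitone_of_isMaxOn_headSumVec hstab hanti haS hmax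
  have ha : Antitone a ∧ ∀ i, a (Fin.rev i) = -a i := ⟨hmono, hanti a haS⟩
  -- the antidominant operator `T_{-a}` and its transform `F = v x^a + lower terms`, `v` a unit
  set Ta : heckeAlgebra R (unitaryGroupOfForm σ ((StdForm.antidiagonal N).over K)) (unitaryInt σ ((StdForm.antidiagonal N).over K)) :=
    heckeAlgebra.doubleCosetOperator (unitaryInt σ ((StdForm.antidiagonal N).over K))
      (⟨zpowDiagGL (uniformizer_ne_zero hd.vϖ) (-a), zpowDiagGL_mem_unitaryGroupOfForm hd.σϖ _ (neg_rev_of_rev ha.2)⟩ :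
        unitaryGroupOfForm σ ((StdForm.antidiagonal N).over K)) with hTa
  set F := (hd.isIwasawaExponent (N := N)).satakeTransform w Ta with hFdef
  have hc : F.coeff a = ((u ^ (-satakeTwistExp (-a)) : Rˣ) : R) := by
    rw [hFdef, hTa, hd.coeff_neg_satakeTransform_doubleCosetOperator_zpowDiagGL_neg hσ u hu w hw ha, hw]
  have htri : ∀ μ, F.coeff μ ≠ 0 → ∀ r, headSum μ r ≤ headSum a r := fun μ hμ r =>
    hd.headSum_le_of_coeff_satakeTransform_doubleCosetOperator_zpowDiagGL_neg_ne_zero hσ u hu w hw ha hμ r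
  have hF : F ∈ unitarySatakeTarget R N := hd.isIwasawaExponent_satakeTransform_mem_unitarySatakeTarget hσ u hu w hw Ta
  -- `g = f - f_a v⁻¹ F`
  set k : R := f.coeff a * (((u ^ (-satakeTwistExp (-a)))⁻¹ : Rˣ) : R) with hk
  set g := f - k • F with hgdef
  have hg : g ∈ unitarySatakeTarget R N := Subalgebra.sub_mem _ hf (Subalgebra.smul_mem _ hF k)
  have hgcoeff : ∀ μ, g.coeff μ = f.coeff μ - k * F.coeff μ := fun μ => by
    rw [hgdef, AddMonoidAlgebra.coeff_sub, AddMonoidAlgebra.coeff_smul, Finsupp.sub_apply, Finsupp.smul_apply, smul_eq_mul]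
  have hga : g.coeff a = 0 := by rw [hgcoeff, hk, hc, Units.inv_mul_cancel_right, sub_self]
  have hgsupp : ∀ μ, g.coeff μ ≠ 0 → f.coeff μ ≠ 0 ∨ F.coeff μ ≠ 0 := fun μ h => by
    by_contra h'
    rw [not_or, not_ne_iff, not_ne_iff] at h'
    exact h (by rw [hgcoeff, h'.1, h'.2, mul_zero, sub_zero])
  -- `U(g) ⊊ U(f)`
  have hsub : lowerDominantSet g ⊆ lowerDominantSet f := by
    rintro la ⟨h1, h2, b, hb, hbm, hle⟩
    rcases hgsupp b hb with hbf | hbF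
    · exact ⟨h1, h2, b, hbf, hbm, hle⟩
    · exact ⟨h1, h2, a, haS', hmono, fun r => (hle r).trans (htri b hbF r)⟩
  have haU : a ∈ lowerDominantSet f := ⟨hmono, ha.2, a, haS', hmono, fun _ => le_rfl⟩
  have haU' : a ∉ lowerDominantSet g := by
    rintro ⟨-, -, b, hb, -, hle⟩
    have hba : a = b := by
      rcases hgsupp b hb with hbf | hbF
      · exact eq_of_headSum_le_of_toLex_le hle (hmax b (Finsupp.mem_support_iff.2 hbf))
      · exact eq_of_headSum_le_antisymm hle (htri b hbF)
    rw [← hba] at hb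
    exact hb hga
  have hlt : (finite_lowerDominantSet g).toFinset.card < (finite_lowerDominantSet f).toFinset.card :=
    Finset.card_lt_card (Set.Finite.toFinset_ssubset_toFinset.2 ((Set.ssubset_iff_of_subset hsub).2 ⟨a, haU, haU'⟩))
  obtain ⟨T', hT'⟩ := ih _ (hm ▸ hlt) g hg rfl
  refine ⟨T' + k • Ta, ?_⟩
  rw [map_add, map_smul, hT', hgdef, sub_add_cancel]

/-- **`range 𝒮_w = R[Λ⁻]^W`** over every commutative ring `R` with `q_F ∈ Rˣ`. [cite: CartierCorvallis1979, §IV Thm. 4.1]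
[cite: Satake1963, §6 Thm. 7] -/
theorem range_isIwasawaExponent_satakeTransform_eq_unitarySatakeTarget (hd : UnramifiedLocalConjDatum σ ϖ) (hσ : ∃ x : K, σ x ≠ x)
    (u : Rˣ) (hu : (u : R) = Nat.sqrt (Nat.card 𝓀[K])) (w : Multiplicative (Fin N → ℤ) →* R)
    (hw : ∀ e : Fin N → ℤ, w (Multiplicative.ofAdd e) = ((u ^ (-satakeTwistExp e) : Rˣ) : R)) :
    ((hd.isIwasawaExponent (N := N)).satakeTransform w).range = unitarySatakeTarget R N :=
  le_antisymm (by
      rintro f ⟨T, rfl⟩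
      exact hd.isIwasawaExponent_satakeTransform_mem_unitarySatakeTarget hσ u hu w hw T)
    fun f hf => (AlgHom.mem_range _).2 (hd.exists_isIwasawaExponent_satakeTransform_eq hσ u hu w hw f hf)

/-- **THE SATAKE ISOMORPHISM OF `U(σ, J₀^{(N)})` OVER EVERY COMMUTATIVE RING `R` WITH `q_F ∈ Rˣ`, IN EVERY RANK**:
`𝒮_w : ℋ(U(σ, J₀^{(N)}), K₀; R) ⥲ R[Λ⁻]^W` (`w = u^{-⟨ν,·⟩}`, `(u : R) = q_F`; `σ ≠ id`, finite residue field; `K₀` hyperspecial)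
— an isomorphism of `R`-algebras onto the Weyl invariants of the group algebra of the antisymmetric cocharacters.  Injectivity:
`satakeTransform_injective_of_commRing` (any `R`); surjectivity: `exists_isIwasawaExponent_satakeTransform_eq`.
[cite: CartierCorvallis1979, §IV Thm. 4.1] [cite: Satake1963, §6 Thm. 7] [cite: Minguez2011, §4] -/
def satakeAlgEquivOfUnits (hd : UnramifiedLocalConjDatum σ ϖ) (hσ : ∃ x : K, σ x ≠ x) (u : Rˣ)
    (hu : (u : R) = Nat.sqrt (Nat.card 𝓀[K])) (w : Multiplicative (Fin N → ℤ) →* R)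
    (hw : ∀ e : Fin N → ℤ, w (Multiplicative.ofAdd e) = ((u ^ (-satakeTwistExp e) : Rˣ) : R)) :
    heckeAlgebra R (unitaryGroupOfForm σ ((StdForm.antidiagonal N).over K)) (unitaryInt σ ((StdForm.antidiagonal N).over K)) ≃ₐ[R]
      unitarySatakeTarget R N :=
  AlgEquiv.ofBijective
    (((hd.isIwasawaExponent (N := N)).satakeTransform w).codRestrict (unitarySatakeTarget R N) fun T =>
      hd.isIwasawaExponent_satakeTransform_mem_unitarySatakeTarget hσ u hu w hw T)
    ⟨fun T T' h => hd.satakeTransform_injective_of_commRing w (congrArg Subtype.val h),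
      fun f => by
        obtain ⟨T, hT⟩ := hd.exists_isIwasawaExponent_satakeTransform_eq hσ u hu w hw f.1 f.2
        exact ⟨T, Subtype.ext hT⟩⟩

/-- The integral Satake isomorphism is the integral Satake transform `𝒮_w`. [cite: CartierCorvallis1979, §IV Thm. 4.1] -/
@[simp] theorem coe_satakeAlgEquivOfUnits (hd : UnramifiedLocalConjDatum σ ϖ) (hσ : ∃ x : K, σ x ≠ x) (u : Rˣ)
    (hu : (u : R) = Nat.sqrt (Nat.card 𝓀[K])) (w : Multiplicative (Fin N → ℤ) →* R)
    (hw : ∀ e : Fin N → ℤ, w (Multiplicative.ofAdd e) = ((u ^ (-satakeTwistExp e) : Rˣ) : R))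
    (T : heckeAlgebra R (unitaryGroupOfForm σ ((StdForm.antidiagonal N).over K)) (unitaryInt σ ((StdForm.antidiagonal N).over K))) :
    ((hd.satakeAlgEquivOfUnits hσ u hu w hw T : unitarySatakeTarget R N) : AddMonoidAlgebra R (Fin N → ℤ)) =
      (hd.isIwasawaExponent (N := N)).satakeTransform w T := rfl

/-- The inverse isomorphism recovers the Hecke operator from its transform: `𝒮_w⁻¹(𝒮_w T) = T`. [cite: CartierCorvallis1979, §IV Thm. 4.1] -/
theorem satakeAlgEquivOfUnits_symm_apply_satakeTransform (hd : UnramifiedLocalConjDatum σ ϖ) (hσ : ∃ x : K, σ x ≠ x) (u : Rˣ)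
    (hu : (u : R) = Nat.sqrt (Nat.card 𝓀[K])) (w : Multiplicative (Fin N → ℤ) →* R)
    (hw : ∀ e : Fin N → ℤ, w (Multiplicative.ofAdd e) = ((u ^ (-satakeTwistExp e) : Rˣ) : R))
    (T : heckeAlgebra R (unitaryGroupOfForm σ ((StdForm.antidiagonal N).over K)) (unitaryInt σ ((StdForm.antidiagonal N).over K))) :
    (hd.satakeAlgEquivOfUnits hσ u hu w hw).symm
        ⟨(hd.isIwasawaExponent (N := N)).satakeTransform w T, hd.isIwasawaExponent_satakeTransform_mem_unitarySatakeTarget hσ u hu w hw T⟩ = T :=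
  (hd.satakeAlgEquivOfUnits hσ u hu w hw).injective (by
    rw [AlgEquiv.apply_symm_apply]
    exact Subtype.ext (hd.coe_satakeAlgEquivOfUnits hσ u hu w hw T).symm)

/-- **Whenever `q_F` is a unit of `R`, `ℋ(U(σ, J₀^{(N)}), K₀; R) ≅ R[Λ⁻]^W` as `R`-algebras** (e.g. `R = ℤ[1/p]`, `R = 𝔽̄_ℓ` with
`ℓ ∤ q`, any field of characteristic prime to `q`). [cite: CartierCorvallis1979, §IV Thm. 4.1] [cite: Minguez2011, §4] -/
theorem nonempty_algEquiv_of_isUnit (hd : UnramifiedLocalConjDatum σ ϖ) (hσ : ∃ x : K, σ x ≠ x)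
    (hq : IsUnit ((Nat.sqrt (Nat.card 𝓀[K]) : ℕ) : R)) :
    Nonempty (heckeAlgebra R (unitaryGroupOfForm σ ((StdForm.antidiagonal N).over K)) (unitaryInt σ ((StdForm.antidiagonal N).over K)) ≃ₐ[R]
      unitarySatakeTarget R N) := by
  obtain ⟨u, hu⟩ := hq
  obtain ⟨w, hw⟩ := exists_weight_units_zpow_neg_satakeTwistExp (N := N) (R := R) u
  exact ⟨hd.satakeAlgEquivOfUnits hσ u hu w hw⟩

/-! ## §3 The complex case -/

omit [Finite 𝓀[K]]
  [IsHeckeTriple (⊤ : Submonoid (unitaryGroupOfForm σ ((StdForm.antidiagonal N).over K)))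
    (unitaryInt σ ((StdForm.antidiagonal N).over K)) (unitaryInt σ ((StdForm.antidiagonal N).over K))] in
/-- **The complex Satake isomorphism recovered**: for `R = ℂ`, `u = √q` (a unit, `= q_F`) and the weight `satakeWeightHom √q`,
the integral isomorphism `satakeAlgEquivOfUnits` is the tree's `ℂ`-valued Satake transform `hd.satakeTransform` (hence agrees with
`satakeAlgEquiv`). [cite: CartierCorvallis1979, §IV (4.2), Thm. 4.1] -/
theorem coe_satakeAlgEquivOfUnits_complex (hd : UnramifiedLocalConjDatum σ ϖ) [Finite 𝓀[K]]
    [IsHeckeTriple (⊤ : Submonoid (unitaryGroupOfForm σ ((StdForm.antidiagonal N).over K)))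
      (unitaryInt σ ((StdForm.antidiagonal N).over K)) (unitaryInt σ ((StdForm.antidiagonal N).over K))]
    (hσ : ∃ x : K, σ x ≠ x)
    (T : heckeAlgebra ℂ (unitaryGroupOfForm σ ((StdForm.antidiagonal N).over K)) (unitaryInt σ ((StdForm.antidiagonal N).over K))) :
    ((hd.satakeAlgEquivOfUnits hσ (Units.mk0 (residueCardSqrt K) residueCardSqrt_ne_zero)
        (by rw [Units.val_mk0, hd.residueCardSqrt_eq_natCast_sqrt hσ])
        (satakeWeightHom (residueCardSqrt K) residueCardSqrt_ne_zero) satakeWeightHom_ofAdd_eq_units_zpow T :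
        unitarySatakeTarget ℂ N) : AddMonoidAlgebra ℂ (Fin N → ℤ)) = hd.satakeTransform T := by
  rw [coe_satakeAlgEquivOfUnits, hd.satakeTransform_eq_isIwasawaExponent_satakeTransform]

end UnramifiedLocalConjDatum

end Literature.NumberTheory.Automorphic.HermitianLattice

end
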